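import Mathlib.MeasureTheory.Integral.Bochner.Basic
import Mathlib.Analysis.SpecialFunctions.Exp
import Mathlib.MeasureTheory.Integral.IntegrableOn
import Literature.Analysis.FunctionSpaces.BesselJ
import HarnessLib

-- provenance: harness21/H21/H21/Prelude/Sobolev/LiebWuIntegrals.lean @ 8ab0aae (interim HEAD d8f2665); M5 mechanical rewrite
/-!
# The Lieb–Wu integrals for the half-filled Hubbard chain

Trunk: Sobolev (prelude item C11', application of the notion `bessel_J`).

This file contains the analytic half of hubbard.S10 (plain text on purpose: the statement id
is carried by the hubbard-trunk file that combines these closed forms with the Hubbard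
Hamiltonian at half filling and the thermodynamic limit).

Lieb and Wu (*Absence of Mott transition in an exact solution of the short-range one-band
model in one dimension*, Phys. Rev. Lett. **20** (1968) 1445, eqs. (19)–(22); rigorous
derivation in Lieb–Wu, Physica A **321** (2003) 1) computed, via the Bethe ansatz, the
ground-state energy per site of the one-dimensional Hubbard chain at half filling,
`e(U) = -4 ∫₀^∞ J₀(ω) J₁(ω) / (ω (1 + exp(ω U / 2))) dω` (`U > 0`),
and the charge gap
`μ₊ - μ₋ = U - 4 + 8 ∫₀^∞ J₁(ω) / (ω (1 + exp(ω U / 2))) dω`,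
which is strictly positive for every `U > 0` (Mott insulator, no Mott transition at `U > 0`)
and vanishes at `U = 0`. Here `J₀, J₁` are the Bessel functions of the first kind
(`Literature.Analysis.FunctionSpaces.besselJ`, prelude file `BesselJ`).

We define the two closed forms as real numbers depending on `U : ℝ` and state:
integrability of the integrands on `(0, ∞)`, positivity of the gap for `U > 0`, the value
`0` of the gap at `U = 0` (Weber–Schafheitlin: `∫₀^∞ J₁(ω)/ω dω = 1`), and the free-fermion
limit `e(U) → -4/π` as `U → 0⁺`.

## Mathlib

Mathlib has no Bessel functions and hence none of these integrals; the set integral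
`∫ ω in Set.Ioi 0, …`, `IntegrableOn`, `Real.exp` and `Filter.Tendsto` are Mathlib's.

## Design choices

* Namespace `Literature.Hubbard`, as requested by the outline, so that the hubbard trunk can refer to
  `Hubbard.liebWuEnergy` / `Hubbard.liebWuChargeGap` directly.
* The integrands are named (`liebWuEnergyIntegrand`, `liebWuChargeGapIntegrand`) so that the
  integrability lemmas have a clean statement; the closed forms unfold to the formulas of the
  outline by `rfl` (`liebWuEnergy_eq`, `liebWuChargeGap_eq`).
* The definitions make sense for every real `U` (Bochner integral, junk value `0` if the
  integrand were not integrable); the integrability lemmas show that no junk value arises for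
  `U > 0` (energy) and `U ≥ 0` (gap). At `U = 0` the energy integrand `J₀ J₁ / (2ω)` is still
  integrable, but the physical statement is for `U > 0` only, matching Lieb–Wu.
-/

noncomputable section

open scoped Topology
open Filter MeasureTheory Set Real

namespace Literature.Analysis.FunctionSpaces

section Hubbard

/-- The integrand `J₀(ω) J₁(ω) / (ω (1 + exp(ω U / 2)))` of the Lieb–Wu ground-state energy
formula (Lieb–Wu, PRL 20 (1968) 1445, eq. (20)); analytic half of hubbard.S10. [folklore] -/
def liebWuEnergyIntegrand (U ω : ℝ) : ℝ :=
  besselJ 0 ω * besselJ 1 ω / (ω * (1 + Real.exp (ω * U / 2)))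

/-- The integrand `J₁(ω) / (ω (1 + exp(ω U / 2)))` of the Lieb–Wu charge-gap formula
(Lieb–Wu, PRL 20 (1968) 1445, eq. (22)); analytic half of hubbard.S10. [folklore] -/
def liebWuChargeGapIntegrand (U ω : ℝ) : ℝ :=
  besselJ 1 ω / (ω * (1 + Real.exp (ω * U / 2)))

/-- The **Lieb–Wu ground-state energy per site** of the half-filled Hubbard chain (hopping
`t = 1`, interaction `U`):
`e(U) = -4 ∫₀^∞ J₀(ω) J₁(ω) / (ω (1 + exp(ω U / 2))) dω`
(Lieb–Wu, PRL 20 (1968) 1445, eq. (20); Physica A 321 (2003) 1). Analytic half of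
hubbard.S10. [folklore] -/
def liebWuEnergy (U : ℝ) : ℝ :=
  -4 * ∫ ω in Ioi (0 : ℝ), liebWuEnergyIntegrand U ω

/-- The **Lieb–Wu charge gap** `μ₊ - μ₋` of the half-filled Hubbard chain (hopping `t = 1`,
interaction `U`):
`Δ(U) = U - 4 + 8 ∫₀^∞ J₁(ω) / (ω (1 + exp(ω U / 2))) dω`
(Lieb–Wu, PRL 20 (1968) 1445, eq. (22); Physica A 321 (2003) 1). Analytic half of
hubbard.S10. [folklore] -/
def liebWuChargeGap (U : ℝ) : ℝ :=
  U - 4 + 8 * ∫ ω in Ioi (0 : ℝ), liebWuChargeGapIntegrand U ω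

/-- Unfolding of `liebWuEnergy` to the formula of Lieb–Wu, PRL 20 (1968) 1445, eq. (20). [folklore] -/
theorem liebWuEnergy_eq (U : ℝ) :
    liebWuEnergy U = -4 * ∫ ω in Ioi (0 : ℝ),
      besselJ 0 ω * besselJ 1 ω / (ω * (1 + Real.exp (ω * U / 2))) :=
  rfl

/-- Unfolding of `liebWuChargeGap` to the formula of Lieb–Wu, PRL 20 (1968) 1445, eq. (22). [folklore] -/
theorem liebWuChargeGap_eq (U : ℝ) :
    liebWuChargeGap U = U - 4 + 8 * ∫ ω in Ioi (0 : ℝ),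
      besselJ 1 ω / (ω * (1 + Real.exp (ω * U / 2))) :=
  rfl

/-- For `U > 0` the Lieb–Wu energy integrand `J₀ J₁ / (ω (1 + e^{ωU/2}))` is integrable on
`(0, ∞)`: near `0` it is bounded (`J₁(ω)/ω → 1/2`), and at infinity it decays exponentially
(indeed already `J₀ J₁ / ω = O(ω⁻²)` by DLMF 10.17.3). Lieb–Wu, Physica A 321 (2003) 1, §5;
analytic half of hubbard.S10. [cite: LiebWuPhysicaA2003, §5] -/
def integrableOn_liebWuEnergy_integrand : Prop :=
  ∀ {U : ℝ} (hU : 0 < U),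
    IntegrableOn (liebWuEnergyIntegrand U) (Ioi 0)

/-- For `U ≥ 0` the Lieb–Wu charge-gap integrand `J₁ / (ω (1 + e^{ωU/2}))` is integrable on
`(0, ∞)`: `J₁(ω)/ω` is bounded near `0` and `O(ω^{-3/2})` at infinity (DLMF 10.17.3), and
`0 < (1 + e^{ωU/2})⁻¹ ≤ 1`. Lieb–Wu, Physica A 321 (2003) 1, §5; analytic half of
hubbard.S10. [cite: LiebWuPhysicaA2003, §5] -/
def integrableOn_liebWuChargeGap_integrand : Prop :=
  ∀ {U : ℝ} (hU : 0 ≤ U),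
    IntegrableOn (liebWuChargeGapIntegrand U) (Ioi 0)

/-- **Mott insulator for all `U > 0`** (as a property of the closed form): the Lieb–Wu charge
gap is strictly positive for every `U > 0` (Lieb–Wu, PRL 20 (1968) 1445, discussion after
eq. (22); Physica A 321 (2003) 1, Theorem on p. 3). Analytic half of hubbard.S10. [cite: LiebWuPRL1968, discussion after eq. (22)] -/
def liebWuChargeGap_pos : Prop :=
  ∀ {U : ℝ} (hU : 0 < U),
    0 < liebWuChargeGap U

/-- At `U = 0` the Lieb–Wu charge gap vanishes: `∫₀^∞ J₁(ω) / (2ω) dω = 1/2`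
(Weber–Schafheitlin, DLMF 10.22.43), so `0 - 4 + 8 · (1/2) = 0` (Lieb–Wu, PRL 20 (1968)
1445, after eq. (22)). Analytic half of hubbard.S10. [cite: LiebWuPRL1968, discussion after eq. (22); DLMF 10.22.43] -/
def liebWuChargeGap_zero : Prop :=
  liebWuChargeGap 0 = 0

/-- Free-fermion limit of the Lieb–Wu energy: `e(U) → -4/π` as `U → 0⁺`, the ground-state
energy per site of the half-filled tight-binding chain (Lieb–Wu, PRL 20 (1968) 1445, after
eq. (20); Physica A 321 (2003) 1, §6). Analytic half of hubbard.S10. [cite: LiebWuPRL1968, discussion after eq. (20)] -/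
def tendsto_liebWuEnergy_zero : Prop :=
  Tendsto liebWuEnergy (𝓝[>] 0) (𝓝 (-4 / π))

end Hubbard

end Literature.Analysis.FunctionSpaces
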